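import Literature.Computability.QuantumComplexity.KeyedOracleBlocksFamily
import HarnessLib

/-!
# The keyed TRUNCATED-RUNS blocks family: one block per oracle gate (its truncation) and one full run, kernel semantics

Topic `Literature/Computability/QuantumComplexity`; the instance of the keyed blocks family (`KeyedOracleBlocksFamily.lean`)
used to estimate BBBV query magnitudes and the acceptance probability of an oracle algorithm `F` relative to keyed
oracles IN ONE CIRCUIT: on instances of length `L`, with `n = nOf L` and `T = #oracle gates of F.circ n`, there are
`M = T + 1` blocks; block `b < T` runs the TRUNCATION of `F.circ n` before its `b`-th oracle gate (`oraclePositions`,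
`QueryWeightsTruncation.lean`), block `T` runs `F.circ n` itself. By `KeyedBlocks.kernelProb_family_eq_avg_probEvent`
and the truncated-run identity (`queryWeights_getElem`): the probability that block `b`'s transported query register
(of the `b`-th oracle gate) spells a string of `D` is the key-average of the `b`-th query magnitude of `F.circ n` on the
block's input relative to the keyed slices (Bennett–Bernstein–Brassard–Vazirani 1997, Def. 3.2, proof of Cor. 3.4:
"run the machine until just before the `i`-th query and measure the query tape"; keyed oracles: Zhandry 2012, Thm. 3.1),
and an event on block `T` has the key-average of `F`'s kernel.

* `truncGates gs M b` — the gate list of block `b`: the prefix of `gs` before its `b`-th oracle gate if `b < #oracle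
  gates`, else `gs`; `KeyedBlocks.trunc F nOf κOf` — the truncated-runs blocks family (`nOf` is clipped to `0` on lengths
  where `(T+1)·n > L`, so the segments always fit); `trunc_nOf_of_le`, `trunc_MOf`;
* **`KeyedBlocks.trunc_kernelProb_query`** — block `b < T`:
  `kernelProb A z {s | queryOf e_b (i ↦ s[E b i]) ∈ D} = 2^{-κ} Σ_key (queryWeights A⟨z.drop (M·n) ++ key⟩ D (F.circ n).gates |z_b 0^m⟩)[b]`;
* **`KeyedBlocks.trunc_kernelProb_full`** — block `T` (the full run), for a segment `z_T = x`:
  `kernelProb A z {s | (i ↦ s[E T i]) spells a string of E} = 2^{-κ} Σ_key F.kernelProb A⟨z.drop (M·n) ++ key⟩ x E`.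

Everything here is PROVED; definitions are explicit.

## References

* C. H. Bennett, E. Bernstein, G. Brassard, U. Vazirani, *Strengths and weaknesses of quantum computing*, SIAM J.
  Comput. 26 (1997) 1510–1523, Def. 3.2, Cor. 3.4 (proof), §4 [BennettBernsteinBrassardVazirani1997].
* M. Zhandry, *Secure identity-based encryption in the quantum random oracle model*, CRYPTO 2012, Thm. 3.1 [Zhandry2012].
* M. A. Nielsen, I. L. Chuang, *Quantum Computation and Quantum Information*, CUP 2010, §2.2.8 [NielsenChuang2010].
-/

noncomputable section

namespace Literature.Computability.QuantumComplexity

open Cryptography Matrix Finset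

/-- **The gate list of block `b`**: the truncation of `gs` before its `b`-th oracle gate (`b < #oracle gates`), else the
whole of `gs` (the full run). [cite: BennettBernsteinBrassardVazirani1997, Cor. 3.4 (proof: the run before the i-th query)] -/
def truncGates {G : QGateSet} {N : ℕ} (gs : List (QGate G N)) (M : ℕ) (b : Fin M) : List (QGate G N) :=
  if h : (b : ℕ) < (oraclePositions gs).length then ((oraclePositions gs)[(b : ℕ)]).1 else gs

/-- Block `b < #oracle gates` is the truncation. [cite: BennettBernsteinBrassardVazirani1997, Cor. 3.4 (proof)] -/
theorem truncGates_of_lt {G : QGateSet} {N : ℕ} (gs : List (QGate G N)) (M : ℕ) (b : Fin M)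
    (h : (b : ℕ) < (oraclePositions gs).length) : truncGates gs M b = ((oraclePositions gs)[(b : ℕ)]).1 := by
  rw [truncGates, dif_pos h]

/-- The other blocks are full runs. [cite: BennettBernsteinBrassardVazirani1997, §4] -/
theorem truncGates_of_le {G : QGateSet} {N : ℕ} (gs : List (QGate G N)) (M : ℕ) (b : Fin M)
    (h : (oraclePositions gs).length ≤ (b : ℕ)) : truncGates gs M b = gs := by
  rw [truncGates, dif_neg (by omega)]

namespace KeyedBlocks

/-- The clipped input length: `n = nOf L` if `(T(n) + 1)·n ≤ L`, else `0`. [cite: Zhandry2012, Thm. 3.1] -/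
def truncNOf (F : QCircuitFamily cliffordT) (nOf : ℕ → ℕ) (L : ℕ) : ℕ :=
  if ((F.circ (nOf L)).oracleQueries + 1) * nOf L ≤ L then nOf L else 0

/-- **The truncated-runs blocks family** of the oracle algorithm `F` with input-length function `nOf` and key-width
function `κOf`: `T(n) + 1` blocks, block `b` running `truncGates (F.circ n).gates _ b`.
[cite: BennettBernsteinBrassardVazirani1997, Cor. 3.4 (proof)] [cite: Zhandry2012, Thm. 3.1] -/
abbrev trunc (F : QCircuitFamily cliffordT) (nOf κOf : ℕ → ℕ) : KeyedBlocks where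
  F := F
  nOf := truncNOf F nOf
  MOf L := (F.circ (truncNOf F nOf L)).oracleQueries + 1
  κOf := κOf
  blockGates L b := truncGates (F.circ (truncNOf F nOf L)).gates _ b
  mul_le L := by
    show ((F.circ (truncNOf F nOf L)).oracleQueries + 1) * truncNOf F nOf L ≤ L
    by_cases h : ((F.circ (nOf L)).oracleQueries + 1) * nOf L ≤ L
    · rw [show truncNOf F nOf L = nOf L from if_pos h]; exact h
    · rw [show truncNOf F nOf L = 0 from if_neg h]; simp

variable (F : QCircuitFamily cliffordT) (nOf κOf : ℕ → ℕ)

/-- On lengths where the segments fit, the input length is `nOf L`. [cite: Zhandry2012, Thm. 3.1] -/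
theorem trunc_nOf_of_le {L : ℕ} (h : ((F.circ (nOf L)).oracleQueries + 1) * nOf L ≤ L) : (trunc F nOf κOf).nOf L = nOf L := by
  show truncNOf F nOf L = nOf L
  rw [truncNOf, if_pos h]

/-- The number of blocks is `T(n) + 1`. [cite: BennettBernsteinBrassardVazirani1997, Cor. 3.4 (proof)] -/
theorem trunc_MOf (L : ℕ) : (trunc F nOf κOf).MOf L = (F.circ ((trunc F nOf κOf).nOf L)).oracleQueries + 1 := rfl

/-- The block gate lists of the truncated-runs family. [cite: BennettBernsteinBrassardVazirani1997, Cor. 3.4 (proof)] -/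
theorem trunc_blockGates (L : ℕ) (b : Fin ((trunc F nOf κOf).MOf L)) :
    (trunc F nOf κOf).blockGates L b = truncGates (F.circ ((trunc F nOf κOf).nOf L)).gates _ b := rfl

/-- **Block `b < T`: the transported query register of the `b`-th oracle gate spells a string of `D` with the
key-averaged `b`-th query magnitude.** [cite: BennettBernsteinBrassardVazirani1997, Def. 3.2, Cor. 3.4]
[cite: Zhandry2012, Thm. 3.1] -/
theorem trunc_kernelProb_query (A : Language Bool) (z : List Bool) (b : Fin ((trunc F nOf κOf).MOf z.length))
    (hb : (b : ℕ) < (oraclePositions (F.circ ((trunc F nOf κOf).nOf z.length)).gates).length)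
    (D : Set (List Bool)) [DecidablePred (· ∈ D)] :
    (trunc F nOf κOf).family.kernelProb A z
        {s | queryOf ((oraclePositions (F.circ ((trunc F nOf κOf).nOf z.length)).gates)[(b : ℕ)]).2.2
          (fun i => s.getD (((trunc F nOf κOf).E z.length b i : Fin (z.length + (trunc F nOf κOf).anc z.length)) : ℕ)
            false) ∈ D} =
      (1 / 2 : ℝ) ^ κOf z.length * ∑ key : QReg (κOf z.length),
        (queryWeights (prefixSlice A (z.drop ((trunc F nOf κOf).MOf z.length * (trunc F nOf κOf).nOf z.length) ++
            List.ofFn key)) D (F.circ ((trunc F nOf κOf).nOf z.length)).gates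
          (basisState (padInput ((trunc F nOf κOf).inpB z b) (F.ancillas ((trunc F nOf κOf).nOf z.length)))))[(b : ℕ)]'(by
            rw [queryWeights_eq_map_oraclePositions, List.length_map]; exact hb) := by
  classical
  erw [(trunc F nOf κOf).kernelProb_family_eq_avg_probEvent A z b
    (fun u => queryOf ((oraclePositions (F.circ ((trunc F nOf κOf).nOf z.length)).gates)[(b : ℕ)]).2.2 u ∈ D)]
  congr 1
  refine Finset.sum_congr rfl fun key _ => ?_
  rw [queryWeights_getElem _ _ _ _ _ hb, trunc_blockGates, truncGates_of_lt _ _ _ hb,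
    ← sum_ite_normSq_toMatrix_eq_probEvent, sum_ite_queryOf_eq_queryWeight]

/-- **Block `T` (the full run): an event on its transported output string has the key-average of `F`'s kernel** at the
block's input `x`. [cite: Zhandry2012, Thm. 3.1] [cite: BennettBernsteinBrassardVazirani1997, §4] -/
theorem trunc_kernelProb_full (A : Language Bool) (z : List Bool) (b : Fin ((trunc F nOf κOf).MOf z.length))
    (hb : (oraclePositions (F.circ ((trunc F nOf κOf).nOf z.length)).gates).length ≤ (b : ℕ))
    (x : List Bool) (hx : x.length = (trunc F nOf κOf).nOf z.length)
    (hseg : (trunc F nOf κOf).inpB z b = fun i => x.get (Fin.cast hx.symm i))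
    (E : Set (List Bool)) [DecidablePred (· ∈ E)] :
    (trunc F nOf κOf).family.kernelProb A z
        {s | List.ofFn (fun i : Fin ((trunc F nOf κOf).nOf z.length + F.ancillas ((trunc F nOf κOf).nOf z.length)) =>
          s.getD (((trunc F nOf κOf).E z.length b i : Fin (z.length + (trunc F nOf κOf).anc z.length)) : ℕ) false) ∈ E} =
      (1 / 2 : ℝ) ^ κOf z.length * ∑ key : QReg (κOf z.length),
        F.kernelProb (prefixSlice A (z.drop ((trunc F nOf κOf).MOf z.length * (trunc F nOf κOf).nOf z.length) ++
          List.ofFn key)) x E := by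
  classical
  erw [(trunc F nOf κOf).kernelProb_family_eq_avg_probEvent A z b (fun u => List.ofFn u ∈ E)]
  congr 1
  refine Finset.sum_congr rfl fun key _ => ?_
  rw [trunc_blockGates, truncGates_of_le _ _ _ hb, hseg]
  exact F.probEvent_ofFn_eq_kernelProb _ x hx E

end KeyedBlocks

end Literature.Computability.QuantumComplexity

end
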